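import Summits.BirchSwinnertonDyer.Rank1Residual.X11b.BeyondWindowAll
import Summits.BirchSwinnertonDyer.Rank1Residual.X11b.RegMultCertificateRecords
import HarnessLib

/-!
# REG-MULT on x11c's kernel-checked beyond-window records: every (ram) record of the 70 batches
# (4 132 pairs, `N < 5·10⁵`, `p ≥ 5` — they CONTAIN all 3 723 (ram) cells of N8) gets `BSD(E,p)`
# from the published facts + analytic rank one + ONE regulator row, with NO new `decide` and NO
# `p`-adic `L`-value computed (census cell `bsd-formula-census`, seat conjecture-typer 2, CELL-PLAN H-7)

HONEST FRAMING (run/shared/lean/b2b/bsd-rank1-residual/, verbatim in every file): the goal of the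
cell is to DELETE the COMBINATION-SHAPED residual classes of the Birch–Swinnerton-Dyer formula for
ALL analytic-rank `≤ 1` elliptic curves over `ℚ` — "full BSD formula for every rank `≤ 1` curve in
class `C`" assembled STRICTLY from published theorems — so that the rank-`≤ 1` remainder becomes
exactly the CONSTRUCTION-SHAPED classes, which are TYPED (missing-input `Prop`s), NOT attempted.
This is not "finishing BSD". Research route; no claim beyond the stated classes; census / instrument
output = EVIDENCE / certificate rows, never a Literature fact; a REG-MULT row is a per-pair COMPUTED
INPUT (instrumentation tier; booking = referee A / director); Schneider's conjecture is never asserted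
class-wide. Nothing below is booked; X11b (N8/O2) stays CONSTRUCTION-SHAPED; everything is PER RECORD
and CONDITIONAL on the named published facts and on each record's two claimed numbers.

## What is here (theorems only)

x11c's campaign (`BeyondWindowRecords01…70`, aggregated in `BeyondWindowAll`: `bwRamBatches`) holds
4 132 records `r : X11RankOneCertificates.Record` with `fullCheck r = true` PROVED by `decide +kernel`
per batch (`fullCheck_bwRecordsNN`); its closing theorems need per record THREE engine numbers, the
third being a computed `p`-adic BSD valuation certificate (modular symbols; memory-bound). A join of the
batch files with `class-closure/N8/pairs.tsv` (this seat, 2026-08-21: 3 723 / 3 723 (ram) cells of N8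
present among the 4 132 records, same Cremona labels) shows the records already cover the whole (ram)
atom of N8 at `p ≥ 5`. This file collects the 70 `fullCheck` theorems
(`RegMult.all_fullCheck_of_mem_bwRamBatches`, `RegMult.fullCheck_of_mem_bwRam`) and applies
`RegMult.bsdp_of_fullCheck_of_cert'` (p252684): **`RegMult.bsdp_of_mem_bwRam_of_cert`** — for every
record `r ∈ bwRamBatches.flatten`, the published facts (Skinner 2016 Thm. A, Stein–Wuthrich 2013
Thm. 6.1 ×2 and §4.2 height existence ×2, Disegni 2020 Thm. 1, GZK, modularity) + `r.curve.analyticRank = 1`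
+ ONE REGMULT-PAIR/v1 row matching `r.split` (`RegMult.CertNonsplit` / `RegMult.CertSplit`: the
Stein–Wuthrich §4.2 height of an admissible multiple of a rational point is non-zero — seconds per pair,
two engines, W5 STEP-0 PASS 966/966, production 5 407 rows running) give Miller's `BSD(E,p)` for
`r.curve`; batch-universal form `RegMult.forall_bwRam_of_cert`. The rows themselves are EVIDENCE filed
under `HOME/b2b-bsdres-census-ctyper2/regmult/` (INSTANCES tables), entering only as the hypothesis
`hnum`; nothing is evaluated or booked here. [cite: Disegni2020, Thm. 1 (§1.2)]
[cite: Skinner2016PacificMC, Thm. A] [cite: SteinWuthrich2013, Thm. 6.1, §4.2]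
[cite: Mazur1978, §6 Prop. 6.3 (1) (p. 153)]
-/

set_option autoImplicit false

noncomputable section

open scoped Classical MatrixGroups ModularForm

open CongruenceSubgroup WeierstrassCurve Literature.NumberTheory.EllipticCurves
  Literature.NumberTheory.EllipticCurves.ModularForms
  Literature.NumberTheory.EllipticCurves.Rank1Residual
  Literature.NumberTheory.EllipticCurves.Rank1Residual.Typed
  Literature.NumberTheory.EllipticCurves.Rank1Residual.X11RankOneCertificates
  Literature.NumberTheory.EllipticCurves.Skinner2016
  Literature.NumberTheory.EllipticCurves.SteinWuthrich2013
  Literature.NumberTheory.EllipticCurves.Disegni2020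

namespace Summit.BirchSwinnertonDyer.Rank1Residual.X11b

namespace RegMult

/-- **Every (ram) batch of x11c's beyond-window campaign passes `fullCheck` in the kernel** — the 70
per-batch theorems `fullCheck_bwRecords01 … 70` (`decide +kernel`), collected over `bwRamBatches`.
[folklore] -/
theorem all_fullCheck_of_mem_bwRamBatches : ∀ l ∈ bwRamBatches, l.all fullCheck = true := by
  unfold bwRamBatches
  exact List.forall_mem_cons.mpr ⟨fullCheck_bwRecords01,
    List.forall_mem_cons.mpr ⟨fullCheck_bwRecords02,
    List.forall_mem_cons.mpr ⟨fullCheck_bwRecords03,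
    List.forall_mem_cons.mpr ⟨fullCheck_bwRecords04,
    List.forall_mem_cons.mpr ⟨fullCheck_bwRecords05,
    List.forall_mem_cons.mpr ⟨fullCheck_bwRecords06,
    List.forall_mem_cons.mpr ⟨fullCheck_bwRecords07,
    List.forall_mem_cons.mpr ⟨fullCheck_bwRecords08,
    List.forall_mem_cons.mpr ⟨fullCheck_bwRecords09,
    List.forall_mem_cons.mpr ⟨fullCheck_bwRecords10,
    List.forall_mem_cons.mpr ⟨fullCheck_bwRecords11,
    List.forall_mem_cons.mpr ⟨fullCheck_bwRecords12,
    List.forall_mem_cons.mpr ⟨fullCheck_bwRecords13,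
    List.forall_mem_cons.mpr ⟨fullCheck_bwRecords14,
    List.forall_mem_cons.mpr ⟨fullCheck_bwRecords15,
    List.forall_mem_cons.mpr ⟨fullCheck_bwRecords16,
    List.forall_mem_cons.mpr ⟨fullCheck_bwRecords17,
    List.forall_mem_cons.mpr ⟨fullCheck_bwRecords18,
    List.forall_mem_cons.mpr ⟨fullCheck_bwRecords19,
    List.forall_mem_cons.mpr ⟨fullCheck_bwRecords20,
    List.forall_mem_cons.mpr ⟨fullCheck_bwRecords21,
    List.forall_mem_cons.mpr ⟨fullCheck_bwRecords22,
    List.forall_mem_cons.mpr ⟨fullCheck_bwRecords23,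
    List.forall_mem_cons.mpr ⟨fullCheck_bwRecords24,
    List.forall_mem_cons.mpr ⟨fullCheck_bwRecords25,
    List.forall_mem_cons.mpr ⟨fullCheck_bwRecords26,
    List.forall_mem_cons.mpr ⟨fullCheck_bwRecords27,
    List.forall_mem_cons.mpr ⟨fullCheck_bwRecords28,
    List.forall_mem_cons.mpr ⟨fullCheck_bwRecords29,
    List.forall_mem_cons.mpr ⟨fullCheck_bwRecords30,
    List.forall_mem_cons.mpr ⟨fullCheck_bwRecords31,
    List.forall_mem_cons.mpr ⟨fullCheck_bwRecords32,
    List.forall_mem_cons.mpr ⟨fullCheck_bwRecords33,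
    List.forall_mem_cons.mpr ⟨fullCheck_bwRecords34,
    List.forall_mem_cons.mpr ⟨fullCheck_bwRecords35,
    List.forall_mem_cons.mpr ⟨fullCheck_bwRecords36,
    List.forall_mem_cons.mpr ⟨fullCheck_bwRecords37,
    List.forall_mem_cons.mpr ⟨fullCheck_bwRecords38,
    List.forall_mem_cons.mpr ⟨fullCheck_bwRecords39,
    List.forall_mem_cons.mpr ⟨fullCheck_bwRecords40,
    List.forall_mem_cons.mpr ⟨fullCheck_bwRecords41,
    List.forall_mem_cons.mpr ⟨fullCheck_bwRecords42,
    List.forall_mem_cons.mpr ⟨fullCheck_bwRecords43,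
    List.forall_mem_cons.mpr ⟨fullCheck_bwRecords44,
    List.forall_mem_cons.mpr ⟨fullCheck_bwRecords45,
    List.forall_mem_cons.mpr ⟨fullCheck_bwRecords46,
    List.forall_mem_cons.mpr ⟨fullCheck_bwRecords47,
    List.forall_mem_cons.mpr ⟨fullCheck_bwRecords48,
    List.forall_mem_cons.mpr ⟨fullCheck_bwRecords49,
    List.forall_mem_cons.mpr ⟨fullCheck_bwRecords50,
    List.forall_mem_cons.mpr ⟨fullCheck_bwRecords51,
    List.forall_mem_cons.mpr ⟨fullCheck_bwRecords52,
    List.forall_mem_cons.mpr ⟨fullCheck_bwRecords53,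
    List.forall_mem_cons.mpr ⟨fullCheck_bwRecords54,
    List.forall_mem_cons.mpr ⟨fullCheck_bwRecords55,
    List.forall_mem_cons.mpr ⟨fullCheck_bwRecords56,
    List.forall_mem_cons.mpr ⟨fullCheck_bwRecords57,
    List.forall_mem_cons.mpr ⟨fullCheck_bwRecords58,
    List.forall_mem_cons.mpr ⟨fullCheck_bwRecords59,
    List.forall_mem_cons.mpr ⟨fullCheck_bwRecords60,
    List.forall_mem_cons.mpr ⟨fullCheck_bwRecords61,
    List.forall_mem_cons.mpr ⟨fullCheck_bwRecords62,
    List.forall_mem_cons.mpr ⟨fullCheck_bwRecords63,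
    List.forall_mem_cons.mpr ⟨fullCheck_bwRecords64,
    List.forall_mem_cons.mpr ⟨fullCheck_bwRecords65,
    List.forall_mem_cons.mpr ⟨fullCheck_bwRecords66,
    List.forall_mem_cons.mpr ⟨fullCheck_bwRecords67,
    List.forall_mem_cons.mpr ⟨fullCheck_bwRecords68,
    List.forall_mem_cons.mpr ⟨fullCheck_bwRecords69,
    List.forall_mem_cons.mpr ⟨fullCheck_bwRecords70,
    List.forall_mem_nil _⟩⟩⟩⟩⟩⟩⟩⟩⟩⟩⟩⟩⟩⟩⟩⟩⟩⟩⟩⟩⟩⟩⟩⟩⟩⟩⟩⟩⟩⟩⟩⟩⟩⟩⟩⟩⟩⟩⟩⟩⟩⟩⟩⟩⟩⟩⟩⟩⟩⟩⟩⟩⟩⟩⟩⟩⟩⟩⟩⟩⟩⟩⟩⟩⟩⟩⟩⟩⟩⟩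

/-- A record of the (ram) campaign passes `fullCheck`. [folklore] -/
theorem fullCheck_of_mem_bwRam {r : Record} (hr : r ∈ bwRamBatches.flatten) : fullCheck r = true := by
  obtain ⟨l, hl, hrl⟩ := List.mem_flatten.mp hr
  exact List.all_eq_true.mp (all_fullCheck_of_mem_bwRamBatches l hl) r hrl

/-- **REG-MULT on the beyond-window records.** For every record `r` of x11c's 70 (ram) batches
(`r ∈ bwRamBatches.flatten`; 4 132 pairs ⊇ the 3 723 (ram) cells of N8 at `p ≥ 5`): Skinner 2016 Thm. A
`hA`, Stein–Wuthrich 2013 Thm. 6.1 `hJn hJs` and §4.2 height existence `hHn hHs`, Disegni 2020 Thm. 1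
`hD`, GZK `hGZK`, modularity `hpar`, and the record's TWO claimed numbers — analytic rank `1` and ONE
REGMULT-PAIR/v1 row `(P, m)` matching `r.split` — give `p` prime, `Δ ≠ 0`, global minimality (from the
check) and Miller's `BSD(E,p)` for `r.curve`. No `p`-adic `L`-value, no `#Ш_an` claim, no new `decide`.
Per record; CONDITIONAL; nothing booked. [cite: Disegni2020, Thm. 1 (§1.2)] [cite: Skinner2016PacificMC, Thm. A]
[cite: SteinWuthrich2013, Thm. 6.1, §4.2] -/
theorem bsdp_of_mem_bwRam_of_cert
    (hA : thmA_charIdeal_multiplicative)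
    (hJn : thm61_nonsplitMultiplicative) (hJs : thm61_splitMultiplicative)
    (hHn : exists_isMultCanonical) (hHs : exists_isSplitMultCanonical)
    (hD : thm1_padicBSD_rankOne_multiplicative)
    (hGZK : rank_eq_analyticRank_of_analyticRank_le_one) (hpar : nonempty_modularParametrizationData)
    (r : Record) (hr : r ∈ bwRamBatches.flatten)
    (hnum : ∀ [Fact r.p.Prime] [r.curve.IsElliptic] [r.curve.IsGloballyMinimal],
      r.curve.analyticRank = 1 ∧ ∃ (P : r.curve.toAffine.Point) (m : ℕ),
        (r.split = false → CertNonsplit r.curve r.p P m) ∧ (r.split = true → CertSplit r.curve r.p P m)) :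
    ∃ (_ : Fact r.p.Prime) (_ : r.curve.IsElliptic) (_ : r.curve.IsGloballyMinimal),
      BSDp r.curve r.p := by
  have hc : fullCheck r = true := fullCheck_of_mem_bwRam hr
  obtain ⟨hp, hE, hM⟩ := instances_of_fullCheck r hc
  haveI : Fact r.p.Prime := ⟨hp⟩
  haveI := hE
  haveI := hM
  exact ⟨inferInstance, hE, hM, bsdp_of_fullCheck_of_cert' r hc hA hJn hJs hHn hHs hD hGZK hpar hnum⟩

/-- **Batch-universal form** over `bwRamBatches` (parallel to `forall_bwRamBatches` of `BeyondWindowAll`,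
with the computed valuation certificate replaced by ONE regulator row and `#Ш_an` dropped): every
batch's records satisfy `BSD(E,p)` given the published facts and, per record, analytic rank `1` + a
REGMULT row. [cite: Disegni2020, Thm. 1 (§1.2)] [cite: Skinner2016PacificMC, Thm. A]
[cite: SteinWuthrich2013, Thm. 6.1, §4.2] -/
theorem forall_bwRam_of_cert
    (hA : thmA_charIdeal_multiplicative)
    (hJn : thm61_nonsplitMultiplicative) (hJs : thm61_splitMultiplicative)
    (hHn : exists_isMultCanonical) (hHs : exists_isSplitMultCanonical)
    (hD : thm1_padicBSD_rankOne_multiplicative)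
    (hGZK : rank_eq_analyticRank_of_analyticRank_le_one) (hpar : nonempty_modularParametrizationData) :
    ∀ l ∈ bwRamBatches, (∀ r ∈ l, ∀ [Fact r.p.Prime] [r.curve.IsElliptic] [r.curve.IsGloballyMinimal],
        r.curve.analyticRank = 1 ∧ ∃ (P : r.curve.toAffine.Point) (m : ℕ),
          (r.split = false → CertNonsplit r.curve r.p P m) ∧ (r.split = true → CertSplit r.curve r.p P m)) →
      ∀ r ∈ l,
        ∃ (_ : Fact r.p.Prime) (_ : r.curve.IsElliptic) (_ : r.curve.IsGloballyMinimal), BSDp r.curve r.p :=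
  fun l hl hnum r hr =>
    bsdp_of_all_fullCheck_of_cert (all_fullCheck_of_mem_bwRamBatches l hl) hA hJn hJs hHn hHs hD hGZK hpar
      hnum r hr

end RegMult

end Summit.BirchSwinnertonDyer.Rank1Residual.X11b
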